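import Mathlib.Analysis.Quaternion
import Literature.MathematicalPhysics.QuantumFieldTheory.Balaban1983to89.Beta.PlaquetteStencil
import Literature.MathematicalPhysics.QuantumFieldTheory.Balaban1983to89.Beta.WilsonVertexKron

/-!
# `BalabanUV.Beta.D1BFx.WilsonLinearGaugeTorus` — road «BF-x» for binder row D1, letter «LG-E′» part 1: THE LINEAR-GAUGE (CONSTANT
# BACKGROUND) WARD IDENTITY OF an3's FIRST-ORDER WILSON VERTEX ON EVERY FINITE LATTICE

HONEST DEPENDENCY (page 1, mandatory): continuum YM on T⁴ ⇐ BetaPertH ∧ nine spine estimates (0/9 proved); BetaPertH ⇐ (D1) ∧ (D4) ∧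
CAP+tail; G-an2-4 gates asym, D1 and NE2/3/4.  HONEST FRAMING (cell contract, verbatim): «discharging `BetaPertH` makes Bałaban's UV
stability UNCONDITIONAL — a real constructive-QFT result; it is NOT the continuum limit and NOT the Clay problem.»  THIS MODULE DISCHARGES
NOTHING of the wall: [folklore] finite non-commutative algebra on a finite periodic lattice over an3's DEFINITIONS (`PlaquetteVertex.jet21`,
`twistW`, `field`, `adM`, `PlaquetteStencil.wilsonVertex₁`), kernel-checked; no `Prop` minted, no definition, nothing printed asserted, 0 sorry,
0 cited facts.  0 wall binders (root-level hW ∕ hR-sockets ∕ hSX-socket ∕ D1Tel ∕ D1Rep — 0 discharged); (K) NOT closed; NOT D1, NOT `BetaPertH`,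
NOT continuum, NOT Clay.

ABSOLUTE RULE (cell charter, verbatim): «No internally-minted statement may enter as a cited fact. Every hypothesis is either kernel-proved in
this package or a verbatim quotation of a PUBLISHED theorem with page reference. The manuscript(s) under audit are NOT citable for their own
disputed steps — they are the thing under adjudication; programme-internal (2001/route/tribunal) claims are never citable.»

WHAT (owner ruling ρ-g9-9, an3 LETTER «LG-E′» (B1), CENSUS v4.1 row «NEEDLE ROWS» / F-g9-1 (3)).  The (V-Δ) field-block stencil of the road is
an3's one-bond Wilson vertex `W₁(e, z, κ, A) = PlaquetteStencil.wilsonVertex₁ e z κ A` (headline `actionJet21_eq_wilsonVertex₁`: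
`−½·jet21(field t v, bondLetter z κ Y) = ½·v ⬝ᵥ W₁(e,z,κ,adM Y) v`).  SUMMED OVER THE BACKGROUND BOND `z` the background becomes the
CONSTANT field `Y` on every `κ`-bond — a flat (abelian, pure-gauge to first order) background — and the first-order vertex collapses to the
adjoint rotation of the fluctuation weighted by the `κ`-coordinate.  On a finite lattice there is no coordinate function; the identity
appears in its LOCAL form, per plaquette, BCH-free:
* §1 `jet21_constDir`: for the constant background `B ≡ (δ = κ ? Y : 0)`, `lcurl B = 0` and an3's `twistW` (`twistW_regroup`) is
  `δ_{μκ}[Y, W_ν(x+e_μ)] − δ_{νκ}[Y, W_μ(x+e_ν)]`, so `jet21(W, B) = 2·Σ_x Σ_ν τ(lcurl W (x,κ,ν) · [Y, W_ν(x + e_κ)])` (`jet21_eq`, `lcurl_swap`);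
  `jet21_sum_bondLetter`: `jet21` is additive in the background and `Σ_z bondLetter z κ Y` IS that constant background.
* §2 `sum_dotProduct_wilsonVertex₁_mulVec` (**LG WARD IDENTITY, quadratic-form level, every finite lattice, every tracial `τ`, every letter
  family**): `Σ_z v ⬝ᵥ W₁(e,z,κ,adM Y) v = 2·Σ_x Σ_ν Σ_{a,b} lcurl(coords v)(x,κ,ν)_a · (adM Y)_{ab} · v(x+e_κ,(b,ν))` (`lcurl_field`, `adM_pairing`).
* §3 POLARISATION + COLOUR STRIPPING (`WilsonVertexKron.wilsonVertex₁_apply_eq_mul_unit`, `adM_antisymm`): with `c_κ(x,α; y,β) :=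
  lcurl e (bondLetter x α 1) (y − e κ) κ β` — the signed incidence of the bond `(x,α)` in the `(κ,β)`-plaquette behind `(y,β)` —
  `(adM Y)_{ab} · Σ_z [W₁(e,z,κ,1)(xα; yβ) − W₁(e,z,κ,1)(yβ; xα)] = 2·(adM Y)_{ab}·(c_κ(x,α;y,β) − c_κ(y,β;x,α))` for every letter family.
* §4 ONE CONCRETE LETTER FAMILY with `(adM Y)_{01} = −2 ≠ 0` (Hamilton's quaternions `ℍ` — a `NormedAlgebra ℝ` of Mathlib, no local
  instance needed — `τ = re` (tracial: `re_mul` is symmetric), `t = (i, j)`, `Y = k`: `re(k·[i,j]) = re(2k²) = −2`) strips the colour factor: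
  **`sum_wilsonVertex₁_one_antisymm`**: on EVERY finite lattice `Λ`, frame `e`, directions `κ, α, β`, sites `x, y`:
  `Σ_z [W₁(e,z,κ,1)((x,α),(y,β)) − W₁(e,z,κ,1)((y,β),(x,α))] = 2·(c_κ(x,α;y,β) − c_κ(y,β;x,α))`.
Part 2 (`D1BFx.WilsonLinearGauge`) transfers this to `ℤ⁴` (an2's `StepJetData.wilsonA`, an3's realisation dictionary) and identifies the right side
with `−½(x_κ − y_κ)·BalabanStepJets.elCol β y α x` (an3's sign word).
Unit `b2b-balaban-beta-d1-formalise-leaf-04` (gen 8); `LEAVES-BFx.md` row «LG-E′».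
-/

open Finset
open scoped BigOperators Matrix
open Literature.MathematicalPhysics.QuantumFieldTheory.Balaban1983to89.Beta
open SpinTable (br)
open PlaquetteVertex (lcurl lcurl_swap lcurl_const lcurl_add lcurl_field bondLetter twistW twistW_regroup jet21 jet21_eq field coords adM
  adM_apply adM_pairing adM_antisymm)
open PlaquetteStencil (wilsonVertex₁ actionJet21_eq_wilsonVertex₁)
open WilsonVertexKron (wilsonVertex₁_apply_eq_mul_unit)

namespace Summit.QuantumFields.BalabanUV.Beta.D1BFx.WilsonLinearGaugeTorus

/-! ## §1 The `(2,1)`-jet at the constant background on the `κ`-bonds -/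

section Jet

variable {𝔸 : Type*} [NormedRing 𝔸] [NormedAlgebra ℝ 𝔸]
variable {Λ : Type*} [Fintype Λ] [AddCommGroup Λ] {D : Type*} [Fintype D] [DecidableEq D]

omit [NormedAlgebra ℝ 𝔸] in
/-- [folklore] A commutator with a conditional letter. -/
theorem br_ite_left (c : Prop) [Decidable c] (Y W : 𝔸) : br (if c then Y else 0) W = if c then br Y W else 0 := by
  split_ifs
  · rfl
  · simp only [br, zero_mul, mul_zero, sub_self]

omit [NormedAlgebra ℝ 𝔸] [Fintype Λ] [Fintype D] in
/-- [folklore] **an3's `twistW` AT THE CONSTANT BACKGROUND `B ≡ Y` ON THE `κ`-BONDS**: `δ_{μκ}[Y, W_ν(x+e_μ)] − δ_{νκ}[Y, W_μ(x+e_ν)]` — the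
accumulated curvature letter of `twistW_regroup` vanishes (`lcurl` of a constant field). -/
theorem twistW_constDir (e : D → Λ) (W : Λ → D → 𝔸) (κ : D) (Y : 𝔸) (x : Λ) (μ ν : D) :
    twistW e W (fun (_ : Λ) (δ : D) => if δ = κ then Y else 0) x μ ν =
      (if μ = κ then br Y (W (x + e μ) ν) else 0) - (if ν = κ then br Y (W (x + e ν) μ) else 0) := by
  rw [twistW_regroup, lcurl_const, br_ite_left, br_ite_left]
  simp only [br, zero_mul, mul_zero, sub_self, sub_zero]

/-- [folklore] **THE `(2,1)`-JET AT THE CONSTANT `κ`-BACKGROUND** (every finite lattice, every tracial `τ`):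
`jet21(W, B ≡ Y on κ-bonds) = 2 · Σ_x Σ_ν τ(lcurl W (x,κ,ν) · [Y, W_ν(x + e_κ)])`. -/
theorem jet21_constDir (τ : 𝔸 →ₗ[ℝ] ℝ) (hτ : ∀ a b : 𝔸, τ (a * b) = τ (b * a)) (e : D → Λ) (W : Λ → D → 𝔸) (κ : D) (Y : 𝔸) :
    jet21 ℝ τ e W (fun (_ : Λ) (δ : D) => if δ = κ then Y else 0) =
      2 * ∑ x, ∑ ν, τ (lcurl e W x κ ν * br Y (W (x + e κ) ν)) := by
  rw [jet21_eq ℝ τ hτ, Finset.mul_sum]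
  refine Finset.sum_congr rfl fun x _ => ?_
  have h1 : ∀ μ ν : D, (2 : ℝ)⁻¹ • τ (lcurl e (fun (_ : Λ) (δ : D) => if δ = κ then Y else 0) x μ ν *
      SpinTable.plaqPairs (W x μ) (W x ν) (W (x + e ν) μ) (W (x + e μ) ν)) = 0 := by
    intro μ ν
    rw [lcurl_const, zero_mul, map_zero, smul_zero]
  simp only [h1, zero_add, twistW_constDir, mul_sub, map_sub, Finset.sum_sub_distrib]
  have h2 : ∑ μ, ∑ ν, τ (lcurl e W x μ ν * if μ = κ then br Y (W (x + e μ) ν) else 0) =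
      ∑ ν, τ (lcurl e W x κ ν * br Y (W (x + e κ) ν)) := by
    rw [Finset.sum_comm]
    refine Finset.sum_congr rfl fun ν _ => ?_
    simp only [mul_ite, mul_zero, apply_ite τ, map_zero]
    rw [Finset.sum_ite_eq' Finset.univ κ]
    simp only [Finset.mem_univ, if_true]
  have h3 : ∑ μ, ∑ ν, τ (lcurl e W x μ ν * if ν = κ then br Y (W (x + e ν) μ) else 0) =
      -∑ μ, τ (lcurl e W x κ μ * br Y (W (x + e κ) μ)) := by
    rw [← Finset.sum_neg_distrib]
    refine Finset.sum_congr rfl fun μ _ => ?_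
    simp only [mul_ite, mul_zero, apply_ite τ, map_zero]
    rw [Finset.sum_ite_eq' Finset.univ κ]
    simp only [Finset.mem_univ, if_true]
    rw [lcurl_swap, neg_mul, map_neg]
  rw [h2, h3, sub_neg_eq_add, two_mul]

omit [DecidableEq D] in
/-- [folklore] `jet21` is additive in the background (visible on `jet21_eq`: `lcurl` and `twistW` are additive in `B`). -/
theorem jet21_add_right (τ : 𝔸 →ₗ[ℝ] ℝ) (hτ : ∀ a b : 𝔸, τ (a * b) = τ (b * a)) (e : D → Λ) (W B B' : Λ → D → 𝔸) :
    jet21 ℝ τ e W (B + B') = jet21 ℝ τ e W B + jet21 ℝ τ e W B' := by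
  rw [jet21_eq ℝ τ hτ, jet21_eq ℝ τ hτ, jet21_eq ℝ τ hτ, ← Finset.sum_add_distrib]
  refine Finset.sum_congr rfl fun x _ => ?_
  rw [← Finset.sum_add_distrib]
  refine Finset.sum_congr rfl fun μ _ => ?_
  rw [← Finset.sum_add_distrib]
  refine Finset.sum_congr rfl fun ν _ => ?_
  have ht : twistW e W (B + B') x μ ν = twistW e W B x μ ν + twistW e W B' x μ ν := by
    simp only [twistW, br, Pi.add_apply]
    noncomm_ring
  rw [lcurl_add, ht, add_mul, mul_add, map_add, map_add, smul_add]
  abel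

omit [DecidableEq D] in
/-- [folklore] `jet21` vanishes at the zero background. -/
theorem jet21_zero_right (τ : 𝔸 →ₗ[ℝ] ℝ) (hτ : ∀ a b : 𝔸, τ (a * b) = τ (b * a)) (e : D → Λ) (W : Λ → D → 𝔸) :
    jet21 ℝ τ e W 0 = 0 := by
  rw [jet21_eq ℝ τ hτ]
  refine Finset.sum_eq_zero fun x _ => Finset.sum_eq_zero fun μ _ => Finset.sum_eq_zero fun ν _ => ?_
  have h0 : lcurl e (0 : Λ → D → 𝔸) x μ ν = 0 := by simp only [lcurl, Pi.zero_apply, sub_self]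
  have ht : twistW e W (0 : Λ → D → 𝔸) x μ ν = 0 := by
    simp only [twistW, br, Pi.zero_apply, zero_mul, mul_zero, sub_self, zero_add]
  rw [h0, ht, zero_mul, mul_zero, map_zero, smul_zero, add_zero]

omit [DecidableEq D] in
/-- [folklore] `jet21` of a finite sum of backgrounds. -/
theorem jet21_sum_right {ι : Type*} (τ : 𝔸 →ₗ[ℝ] ℝ) (hτ : ∀ a b : 𝔸, τ (a * b) = τ (b * a)) (e : D → Λ) (W : Λ → D → 𝔸)
    (s : Finset ι) (B : ι → Λ → D → 𝔸) :
    jet21 ℝ τ e W (∑ i ∈ s, B i) = ∑ i ∈ s, jet21 ℝ τ e W (B i) := by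
  classical
  induction s using Finset.induction_on with
  | empty => rw [Finset.sum_empty, Finset.sum_empty, jet21_zero_right τ hτ]
  | insert i s hi ih => rw [Finset.sum_insert hi, Finset.sum_insert hi, jet21_add_right τ hτ, ih]

omit [NormedAlgebra ℝ 𝔸] [AddCommGroup Λ] [Fintype D] in
/-- [folklore] **THE SUM OF THE ONE-BOND BACKGROUNDS OVER THE BOND SITE IS THE CONSTANT `κ`-BACKGROUND**. -/
theorem sum_bondLetter [DecidableEq Λ] (κ : D) (Y : 𝔸) :
    ∑ z : Λ, (bondLetter z κ Y : Λ → D → 𝔸) = fun (_ : Λ) (δ : D) => if δ = κ then Y else 0 := by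
  funext x δ
  rw [Finset.sum_apply, Finset.sum_apply]
  simp only [bondLetter]
  by_cases hδ : δ = κ
  · simp only [hδ, and_true]
    rw [Finset.sum_ite_eq Finset.univ x]
    simp only [Finset.mem_univ, if_true]
  · simp only [hδ, and_false, if_false, Finset.sum_const_zero]

/-- [folklore] **THE `(2,1)`-JET SUMMED OVER THE BACKGROUND BOND** = the jet at the constant `κ`-background. -/
theorem jet21_sum_bondLetter [DecidableEq Λ] (τ : 𝔸 →ₗ[ℝ] ℝ) (hτ : ∀ a b : 𝔸, τ (a * b) = τ (b * a)) (e : D → Λ) (W : Λ → D → 𝔸)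
    (κ : D) (Y : 𝔸) :
    ∑ z : Λ, jet21 ℝ τ e W (bondLetter z κ Y) = 2 * ∑ x, ∑ ν, τ (lcurl e W x κ ν * br Y (W (x + e κ) ν)) := by
  rw [← jet21_sum_right τ hτ, sum_bondLetter, jet21_constDir τ hτ]

end Jet

/-! ## §2 The LG Ward identity at the level of the quadratic form, in colour coordinates -/

section Form

variable {𝔸 : Type*} [NormedRing 𝔸] [NormedAlgebra ℝ 𝔸]
variable {Λ : Type*} [Fintype Λ] [DecidableEq Λ] [AddCommGroup Λ] {C : Type*} [Fintype C] {D : Type*} [Fintype D] [DecidableEq D]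

omit [Fintype Λ] [DecidableEq Λ] [Fintype D] [DecidableEq D] in
/-- [folklore] The commutator with a coordinate combination: `[Y, Σ_b c_b • t_b] = Σ_b c_b • [Y, t_b]`. -/
theorem br_sum_smul_right (t : C → 𝔸) (Y : 𝔸) (c : C → ℝ) : br Y (∑ b, c b • t b) = ∑ b, c b • br Y (t b) := by
  simp only [br, Finset.mul_sum, Finset.sum_mul, mul_smul_comm, smul_mul_assoc, smul_sub, Finset.sum_sub_distrib]

omit [Fintype Λ] [DecidableEq Λ] [Fintype D] [DecidableEq D] in
/-- [folklore] The trace pairing of a curl letter with a rotated fluctuation letter, in colour coordinates: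
`τ(lcurl(field t v)(x,κ,ν) · [Y, (field t v)_ν(y)]) = −Σ_a Σ_b lcurl(coords v)(x,κ,ν)_a · (adM Y)_{ab} · v(y,(b,ν))`. -/
theorem trace_lcurl_field_mul_br (τ : 𝔸 →ₗ[ℝ] ℝ) (hτ : ∀ a b : 𝔸, τ (a * b) = τ (b * a)) (t : C → 𝔸) (e : D → Λ)
    (v : Λ × (C × D) → ℝ) (Y : 𝔸) (x y : Λ) (κ ν : D) :
    τ (lcurl e (field t v) x κ ν * br Y (field t v y ν)) =
      -∑ a, ∑ b, lcurl e (coords v) x κ ν a * adM τ t Y a b * v (y, (b, ν)) := by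
  rw [lcurl_field, show field t v y ν = ∑ b, v (y, (b, ν)) • t b from rfl, br_sum_smul_right, Finset.sum_mul, map_sum,
    ← Finset.sum_neg_distrib]
  refine Finset.sum_congr rfl fun a _ => ?_
  rw [Finset.mul_sum, map_sum, ← Finset.sum_neg_distrib]
  refine Finset.sum_congr rfl fun b _ => ?_
  rw [smul_mul_assoc, mul_smul_comm, map_smul, map_smul, smul_eq_mul, smul_eq_mul, ← adM_pairing τ hτ, br]
  ring

/-- [folklore] **THE LINEAR-GAUGE WARD IDENTITY OF THE FIRST-ORDER WILSON VERTEX, QUADRATIC-FORM LEVEL** (every finite lattice `Λ`, frame `e`,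
tracial `τ`, letter family `t`, background letter `Y`, bond direction `κ`, fluctuation coordinates `v`):
`Σ_z v ⬝ᵥ W₁(e,z,κ,adM Y) v = 2 · Σ_x Σ_ν Σ_a Σ_b lcurl(coords v)(x,κ,ν)_a · (adM Y)_{ab} · v(x + e_κ,(b,ν))`
— summed over the background bond, the constant (flat) `κ`-background sees only the adjoint rotation of the fluctuation across the
`κ`-direction of each plaquette. -/
theorem sum_dotProduct_wilsonVertex₁_mulVec (τ : 𝔸 →ₗ[ℝ] ℝ) (hτ : ∀ a b : 𝔸, τ (a * b) = τ (b * a)) (t : C → 𝔸) (e : D → Λ)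
    (v : Λ × (C × D) → ℝ) (κ : D) (Y : 𝔸) :
    ∑ z : Λ, v ⬝ᵥ (wilsonVertex₁ e z κ (adM τ t Y) *ᵥ v) =
      2 * ∑ x, ∑ ν, ∑ a, ∑ b, lcurl e (coords v) x κ ν a * adM τ t Y a b * v (x + e κ, (b, ν)) := by
  have h : ∀ z : Λ, v ⬝ᵥ (wilsonVertex₁ e z κ (adM τ t Y) *ᵥ v) = -jet21 ℝ τ e (field t v) (bondLetter z κ Y) := by
    intro z
    have h1 := actionJet21_eq_wilsonVertex₁ τ hτ t e v z κ Y
    have h3 : (2 : ℝ)⁻¹ * (v ⬝ᵥ (wilsonVertex₁ e z κ (adM τ t Y) *ᵥ v)) = (2 : ℝ)⁻¹ * (-jet21 ℝ τ e (field t v) (bondLetter z κ Y)) := by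
      rw [← h1]; ring
    exact mul_left_cancel₀ (by norm_num : (2 : ℝ)⁻¹ ≠ 0) h3
  simp only [h]
  rw [Finset.sum_neg_distrib, jet21_sum_bondLetter τ hτ]
  simp only [trace_lcurl_field_mul_br τ hτ, Finset.sum_neg_distrib, mul_neg, neg_neg]

end Form

/-! ## §3 Polarisation and colour stripping -/

section Strip

variable {𝔸 : Type*} [NormedRing 𝔸] [NormedAlgebra ℝ 𝔸]
variable {Λ : Type*} [Fintype Λ] [DecidableEq Λ] [AddCommGroup Λ] {C : Type*} [Fintype C] [DecidableEq C]
  {D : Type*} [Fintype D] [DecidableEq D]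

omit [Fintype Λ] [Fintype C] [Fintype D] in
/-- [folklore] The curl of the coordinates of a basis vector `δ_{(x₀,(a,α))}`: the `a`-component is the curl of the one-bond field
`bondLetter x₀ α 1`, every other colour component vanishes. -/
theorem lcurl_coords_single (e : D → Λ) (x₀ : Λ) (a : C) (α : D) (x : Λ) (μ ν : D) (a' : C) :
    lcurl e (coords (Pi.single (x₀, (a, α)) (1 : ℝ))) x μ ν a' =
      if a' = a then lcurl e (bondLetter x₀ α (1 : ℝ)) x μ ν else 0 := by
  simp only [lcurl, coords, bondLetter, Pi.sub_apply, Pi.single_apply, Prod.mk.injEq]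
  by_cases ha : a' = a
  · simp only [ha, true_and, if_true]
  · simp only [ha, false_and, and_false, if_false, sub_self]

omit [DecidableEq C] in
/-- [folklore] **POLARISATION of §2**: the symmetrised bilinear identity
`Σ_z (v ⬝ᵥ W₁ w + w ⬝ᵥ W₁ v) = 2·Σ (lcurl(coords v)·adM Y·w + lcurl(coords w)·adM Y·v)`. -/
theorem sum_dotProduct_wilsonVertex₁_mulVec_polar (τ : 𝔸 →ₗ[ℝ] ℝ) (hτ : ∀ a b : 𝔸, τ (a * b) = τ (b * a)) (t : C → 𝔸)
    (e : D → Λ) (v w : Λ × (C × D) → ℝ) (κ : D) (Y : 𝔸) :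
    ∑ z : Λ, (v ⬝ᵥ (wilsonVertex₁ e z κ (adM τ t Y) *ᵥ w) + w ⬝ᵥ (wilsonVertex₁ e z κ (adM τ t Y) *ᵥ v)) =
      2 * ∑ x, ∑ ν, ∑ a, ∑ b, (lcurl e (coords v) x κ ν a * adM τ t Y a b * w (x + e κ, (b, ν))
        + lcurl e (coords w) x κ ν a * adM τ t Y a b * v (x + e κ, (b, ν))) := by
  have hv := sum_dotProduct_wilsonVertex₁_mulVec τ hτ t e v κ Y
  have hw := sum_dotProduct_wilsonVertex₁_mulVec τ hτ t e w κ Y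
  have hvw := sum_dotProduct_wilsonVertex₁_mulVec τ hτ t e (v + w) κ Y
  have coords_add : coords (v + w) = coords v + coords w := rfl
  simp only [coords_add, lcurl_add, Pi.add_apply, Matrix.mulVec_add, dotProduct_add, add_dotProduct, add_mul, mul_add,
    Finset.sum_add_distrib] at hvw ⊢
  linear_combination hvw - hv - hw

omit [Fintype Λ] [AddCommGroup Λ] [Fintype C] [Fintype D] in
/-- [folklore] An entry of the first-order vertex as a matrix element between basis vectors. -/
theorem single_dotProduct_wilsonVertex₁_mulVec_single [Fintype Λ] [AddCommGroup Λ] [Fintype C] [Fintype D] (e : D → Λ) (z : Λ) (κ : D)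
    (A : Matrix C C ℝ) (p q : Λ × (C × D)) :
    Pi.single p (1 : ℝ) ⬝ᵥ (wilsonVertex₁ e z κ A *ᵥ Pi.single q (1 : ℝ)) = wilsonVertex₁ e z κ A p q := by
  rw [Matrix.mulVec_single_one, single_one_dotProduct, Matrix.col_apply]

omit [DecidableEq C] in
/-- [folklore] The right-hand side of the polarised identity between basis vectors `δ_{(x₀,(a,α))}`, `δ_{(y₀,(b,β))}`:
`2·(adM Y)_{ab}·c_κ(x₀,α; y₀,β)` with `c_κ(x₀,α;y₀,β) = lcurl e (bondLetter x₀ α 1) (y₀ − e κ) κ β`. -/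
theorem lgForm_single_single [DecidableEq C] (e : D → Λ) (A : Matrix C C ℝ) (κ : D) (x₀ y₀ : Λ) (a b : C) (α β : D) :
    2 * ∑ x, ∑ ν, ∑ a', ∑ b', lcurl e (coords (Pi.single (x₀, (a, α)) (1 : ℝ))) x κ ν a' * A a' b' *
        (Pi.single (y₀, (b, β)) (1 : ℝ) : Λ × (C × D) → ℝ) (x + e κ, (b', ν)) =
      2 * (A a b * lcurl e (bondLetter x₀ α (1 : ℝ)) (y₀ - e κ) κ β) := by
  congr 1
  have hq : ∀ (x : Λ) (ν : D) (b' : C),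
      (Pi.single (y₀, (b, β)) (1 : ℝ) : Λ × (C × D) → ℝ) (x + e κ, (b', ν)) = if x = y₀ - e κ ∧ ν = β ∧ b' = b then 1 else 0 := by
    intro x ν b'
    simp only [Pi.single_apply, Prod.mk.injEq]
    by_cases h : x = y₀ - e κ ∧ ν = β ∧ b' = b
    · rw [if_pos h, if_pos ⟨eq_sub_iff_add_eq.mp h.1, h.2.2, h.2.1⟩]
    · rw [if_neg h, if_neg fun h' => h ⟨eq_sub_iff_add_eq.mpr h'.1, h'.2.2, h'.2.1⟩]
  have inner : ∀ (x : Λ) (ν : D),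
      ∑ a', ∑ b', lcurl e (coords (Pi.single (x₀, (a, α)) (1 : ℝ))) x κ ν a' * A a' b' *
          (Pi.single (y₀, (b, β)) (1 : ℝ) : Λ × (C × D) → ℝ) (x + e κ, (b', ν)) =
        if x = y₀ - e κ then (if ν = β then lcurl e (bondLetter x₀ α (1 : ℝ)) x κ ν * A a b else 0) else 0 := by
    intro x ν
    simp only [hq, lcurl_coords_single]
    by_cases h : x = y₀ - e κ ∧ ν = β
    · simp only [h, true_and, if_true, mul_ite, mul_one, mul_zero]
      simp only [Finset.sum_ite_eq', Finset.mem_univ, if_true, ite_mul, zero_mul]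
    · have hn : ∀ b' : C, ¬(x = y₀ - e κ ∧ ν = β ∧ b' = b) := fun b' hb => h ⟨hb.1, hb.2.1⟩
      simp only [hn, if_false, mul_zero, Finset.sum_const_zero]
      by_cases h1 : x = y₀ - e κ
      · rw [if_pos h1, if_neg fun h2 => h ⟨h1, h2⟩]
      · rw [if_neg h1]
  simp only [inner]
  rw [Finset.sum_comm]
  simp only [Finset.sum_ite_eq', Finset.mem_univ, if_true]
  ring

omit [DecidableEq C] in
/-- [folklore] **THE STRIPPED IDENTITY WITH ITS COLOUR FACTOR** (every letter family): for `A = adM τ t Y` and colours `a, b`,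
`A_{ab} · Σ_z [W₁(e,z,κ,1)((x₀,α),(y₀,β)) − W₁(e,z,κ,1)((y₀,β),(x₀,α))] = 2·A_{ab}·(c_κ(x₀,α;y₀,β) − c_κ(y₀,β;x₀,α))`
(`WilsonVertexKron.wilsonVertex₁_apply_eq_mul_unit`: every colour block of `W₁(A)` is `A ⊗` the colourless table; `adM_antisymm`). -/
theorem adM_mul_sum_wilsonVertex₁_one_antisymm [DecidableEq C] (τ : 𝔸 →ₗ[ℝ] ℝ) (hτ : ∀ a b : 𝔸, τ (a * b) = τ (b * a))
    (t : C → 𝔸) (e : D → Λ) (κ : D) (Y : 𝔸) (x₀ y₀ : Λ) (a b : C) (α β : D) :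
    adM τ t Y a b * ∑ z : Λ, (wilsonVertex₁ e z κ (1 : Matrix Unit Unit ℝ) (x₀, ((), α)) (y₀, ((), β))
        - wilsonVertex₁ e z κ (1 : Matrix Unit Unit ℝ) (y₀, ((), β)) (x₀, ((), α))) =
      2 * (adM τ t Y a b * (lcurl e (bondLetter x₀ α (1 : ℝ)) (y₀ - e κ) κ β - lcurl e (bondLetter y₀ β (1 : ℝ)) (x₀ - e κ) κ α)) := by
  have h := sum_dotProduct_wilsonVertex₁_mulVec_polar τ hτ t e (Pi.single (x₀, (a, α)) 1) (Pi.single (y₀, (b, β)) 1) κ Y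
  simp only [single_dotProduct_wilsonVertex₁_mulVec_single, Finset.sum_add_distrib, mul_add] at h
  rw [lgForm_single_single, lgForm_single_single] at h
  simp only [wilsonVertex₁_apply_eq_mul_unit e _ κ (adM τ t Y)] at h
  rw [adM_antisymm τ t Y a b] at h
  rw [Finset.mul_sum]
  simp only [mul_sub]
  rw [Finset.sum_sub_distrib]
  have h' : ∑ z, adM τ t Y a b * wilsonVertex₁ e z κ 1 (x₀, PUnit.unit, α) (y₀, PUnit.unit, β) +
      ∑ z, -adM τ t Y a b * wilsonVertex₁ e z κ 1 (y₀, PUnit.unit, β) (x₀, PUnit.unit, α) =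
      2 * (adM τ t Y a b * lcurl e (bondLetter x₀ α 1) (y₀ - e κ) κ β) +
        2 * (-adM τ t Y a b * lcurl e (bondLetter y₀ β 1) (x₀ - e κ) κ α) := h
  simp only [neg_mul, Finset.sum_neg_distrib] at h'
  linear_combination h'

end Strip

/-! ## §4 One concrete letter family strips the colour factor -/

section Concrete

open Quaternion

-- The real-part functional of Hamilton's quaternions is Mathlib's `QuaternionAlgebra.reₗ (−1) 0 (−1)` read on the normed algebra
-- `ℍ = ℍ[ℝ,−1,0,−1]` (as `Mathlib.Analysis.Quaternion` does); no declaration is introduced for it.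
/-- [folklore] Unfolding the real-part functional. -/
theorem reH_apply (q : ℍ[ℝ]) : (QuaternionAlgebra.reₗ (-1 : ℝ) (0 : ℝ) (-1 : ℝ)) q = q.re := rfl

/-- [folklore] `re` is tracial on the quaternions. -/
theorem reH_mul_comm (a b : ℍ[ℝ]) :
    (QuaternionAlgebra.reₗ (-1 : ℝ) (0 : ℝ) (-1 : ℝ)) (a * b) = (QuaternionAlgebra.reₗ (-1 : ℝ) (0 : ℝ) (-1 : ℝ)) (b * a) := by
  rw [reH_apply, reH_apply, Quaternion.re_mul, Quaternion.re_mul]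
  ring

/-- [folklore] THE WITNESS: in Hamilton's quaternions with `τ = re`, letters `t = (i, j)` and background letter `Y = k`, `(adM Y)_{01} = −2`. -/
theorem adM_witness :
    adM (𝔸 := ℍ[ℝ]) (QuaternionAlgebra.reₗ (-1 : ℝ) (0 : ℝ) (-1 : ℝ)) ![(⟨0, 1, 0, 0⟩ : ℍ[ℝ]), ⟨0, 0, 1, 0⟩]
      (⟨0, 0, 0, 1⟩ : ℍ[ℝ]) 0 1 = -2 := by
  rw [adM_apply, br]
  simp only [Matrix.cons_val_zero, Matrix.cons_val_one]
  change ((⟨0, 0, 0, 1⟩ : ℍ[ℝ]) * ((⟨0, 1, 0, 0⟩ : ℍ[ℝ]) * (⟨0, 0, 1, 0⟩ : ℍ[ℝ]) - (⟨0, 0, 1, 0⟩ : ℍ[ℝ]) * (⟨0, 1, 0, 0⟩ : ℍ[ℝ]))).re = -2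
  simp
  norm_num

variable {Λ : Type*} [Fintype Λ] [DecidableEq Λ] [AddCommGroup Λ] {D : Type*} [Fintype D] [DecidableEq D]

/-- [folklore] **THE LINEAR-GAUGE WARD IDENTITY OF THE COLOURLESS FIRST-ORDER WILSON TABLE, ANTISYMMETRISED, ON EVERY FINITE LATTICE**:
for every finite additive group `Λ`, frame `e : D → Λ`, bond direction `κ`, legs `(x₀, α)`, `(y₀, β)`:
`Σ_z [W₁(e,z,κ,1)((x₀,α),(y₀,β)) − W₁(e,z,κ,1)((y₀,β),(x₀,α))] = 2·(c_κ(x₀,α;y₀,β) − c_κ(y₀,β;x₀,α))`,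
`c_κ(x,α;y,β) = lcurl e (bondLetter x α 1) (y − e κ) κ β` (the signed incidence of the bond `(x,α)` in the `(κ,β)`-plaquette based at `y − e_κ`).
The physical (V-Δ) field block is `½` of the bracket (an2's `StepJetData.wilsonA`); part 2 reads this on `ℤ⁴`. -/
theorem sum_wilsonVertex₁_one_antisymm (e : D → Λ) (κ : D) (x₀ y₀ : Λ) (α β : D) :
    ∑ z : Λ, (wilsonVertex₁ e z κ (1 : Matrix Unit Unit ℝ) (x₀, ((), α)) (y₀, ((), β))
        - wilsonVertex₁ e z κ (1 : Matrix Unit Unit ℝ) (y₀, ((), β)) (x₀, ((), α))) =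
      2 * (lcurl e (bondLetter x₀ α (1 : ℝ)) (y₀ - e κ) κ β - lcurl e (bondLetter y₀ β (1 : ℝ)) (x₀ - e κ) κ α) := by
  have h := adM_mul_sum_wilsonVertex₁_one_antisymm (𝔸 := ℍ[ℝ]) (QuaternionAlgebra.reₗ (-1 : ℝ) (0 : ℝ) (-1 : ℝ)) reH_mul_comm
    ![(⟨0, 1, 0, 0⟩ : ℍ[ℝ]), ⟨0, 0, 1, 0⟩] e κ (⟨0, 0, 0, 1⟩ : ℍ[ℝ]) x₀ y₀ 0 1 α β
  -- abstract the colour factor (its `Ring ℍ` instance arrives through `NormedRing ℍ`; `convert` bridges the instance paths)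
  obtain ⟨c, hc, hS⟩ : ∃ c : ℝ, c = -2 ∧ c * ∑ z : Λ, (wilsonVertex₁ e z κ (1 : Matrix Unit Unit ℝ) (x₀, ((), α)) (y₀, ((), β))
      - wilsonVertex₁ e z κ (1 : Matrix Unit Unit ℝ) (y₀, ((), β)) (x₀, ((), α))) =
      2 * (c * (lcurl e (bondLetter x₀ α (1 : ℝ)) (y₀ - e κ) κ β - lcurl e (bondLetter y₀ β (1 : ℝ)) (x₀ - e κ) κ α)) :=
    ⟨_, by convert adM_witness, h⟩
  rw [hc] at hS
  linear_combination (-1 / 2 : ℝ) * hS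

end Concrete

end Summit.QuantumFields.BalabanUV.Beta.D1BFx.WilsonLinearGaugeTorus
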